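import Literature.NumberTheory.LFunctions.SchoenfeldPsiDifference
import HarnessLib

/-!
# The `m`-fold differenced explicit formula: unconditional bounds for `ψ(x) − x` from zeros up to a height

Topic `Literature/NumberTheory/LFunctions`. Everything here is PROVED (no named facts).

Rosser (1941) and Rosser–Schoenfeld (1975, Lemma 8) bound `ψ(x) − x` by differencing the explicit
formula for an iterated integral of `ψ` `m` times with a step `h`: `ψ` being non-decreasing,
`h^m ψ(x) ≤ ∫_{[0,h]^{m-1}} (ψ₁(y+h) − ψ₁(y))|_{y = x+∑tᵢ} dt` and symmetrically from below; in the
explicit formula `ψ₁(y) = y²/2 − ∑_ρ m(ρ) y^{ρ+1}/(ρ(ρ+1)) − (log 2π) y + E(y)` (the tree's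
`psiOne_eq_explicit`, `NicolasJExplicit.Rone_eq_explicit`) each zero then contributes
`c(ρ) G_{m-1}(ρ, x)`, `c(ρ) = m(ρ)/(ρ(ρ+1))`, `G_n(ρ,y) = (ρ+1)∫_{[0,h]^{n+1}} (y+∑tᵢ)^ρ dt
= Δ_h^{n+1}[u^{ρ+n+1}](y)/((ρ+2)⋯(ρ+n+1))`, which is bounded in two ways:
`|G_n| ≤ |ρ+1| h^{n+1} (y+(n+1)h)^{Re ρ}` (used for the zeros of small height, known to lie on the
critical line) and `|G_n| ≤ 2^{n+1}(y+(n+1)h)^{Re ρ+n+1}/∏|ρ+i+2|` (used for the others, with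
`Re ρ ≤ 1`). The tree's `SchoenfeldPsiDifference.lean` is the case `m = 1` under RH; this file does
general `m` WITHOUT RH, the input being only that the zeros with `|Im ρ| ≤ T` have real part `1/2`:

* `PsiDifferenced.psi_sub_self_le_general` — for `x > 1`, `h > 0`, `T ≥ 1`, `n ≥ 0`:
  `ψ(x) − x ≤ (n+1)h/2 − log 2π + √(x+(n+1)h)·sumInvNorm T
     + 2^{n+1}(x+(n+1)h)^{n+2} tailPow(n+2, T)/h^{n+1} + x/(2h(x²−1))`;
* `PsiDifferenced.neg_le_psi_sub_self_general` — for `y − (n+1)h > 1`: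
  `ψ(y) − y ≥ −(n+1)h/2 − log 2π − √y·sumInvNorm T − 2^{n+1} y^{n+2} tailPow(n+2, T)/h^{n+1}`,

where `sumInvNorm T = ∑_{|Im ρ| ≤ T} m(ρ)/|ρ|` (`SchoenfeldPsiDifference.lean`) and
`tailPow p T = ∑_{|Im ρ| > T} m(ρ)/|Im ρ|^p` (`PsiDifferenced.tailPow`, convergent for `p ≥ 2`).
Ingredients: forward differences `Δ_h^k` (`fwdDiff`) and their commutation with `∫_0^h`; the
functions `G_n` with the recursion `G_{n+1}(ρ,y) = ∫_0^h G_n(ρ,y+t)dt` (`G_succ`) and the two bounds;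
termwise integration of the zero series (`hasSum_term`, dominated convergence, `n` times); the
iterated averages `itg_n` and the differencing inequalities for `ψ` (`pow_mul_psi_le_itg`,
`itg_le_pow_mul_psi`, Landau); the evaluation of `itg_n` on the explicit formula with the remainder
`0 ≤ Re E(y+h) − Re E(y) ≤ y/(2(y²−1))` (`Phi_le_itg_D_le`). The numerical instantiation with the
tree's `2000` certified zeros (`T = 2516`) is in `ChebyshevPsiExplicitPartialRH.lean`.

## References

* J. B. Rosser, L. Schoenfeld, *Sharper bounds for the Chebyshev functions θ(x) and ψ(x)*, Math.
  Comp. 29 (1975), 243–269, Lemma 8 (the `m`-fold differences) and Lemma 7. [RosserSchoenfeld1975]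
* L. Schoenfeld, *Sharper bounds … II*, Math. Comp. 30 (1976), 337–360, proof of Thm. 10 (`m = 1`).
  [Schoenfeld1976]
* H. L. Montgomery, R. C. Vaughan, *Multiplicative Number Theory I*, CUP 2007, (13.7). [MontgomeryVaughan2007]
-/

noncomputable section

open Real MeasureTheory Set Filter Topology intervalIntegral
open scoped Chebyshev

namespace Literature.NumberTheory.LFunctions

namespace PsiDifferenced

/-! ### Forward differences of step `h` -/

variable {E : Type*} [NormedAddCommGroup E]

/-- The `k`-th forward difference of step `h`: `Δ⁰F = F`, `Δ^{k+1}F(y) = Δ^k F(y+h) − Δ^k F(y)`. [folklore] -/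
def fwdDiff (h : ℝ) : ℕ → (ℝ → E) → ℝ → E
  | 0, F => F
  | k + 1, F => fun y ↦ fwdDiff h k F (y + h) - fwdDiff h k F y

/-- Auxiliary step (elementary consequence of the definitions and the standing hypotheses). [folklore] -/
@[simp] theorem fwdDiff_zero (h : ℝ) (F : ℝ → E) : fwdDiff h 0 F = F := rfl

/-- Auxiliary step (elementary consequence of the definitions and the standing hypotheses). [folklore] -/
theorem fwdDiff_succ (h : ℝ) (k : ℕ) (F : ℝ → E) (y : ℝ) :
    fwdDiff h (k + 1) F y = fwdDiff h k F (y + h) - fwdDiff h k F y := rfl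

/-- `Δ^{k+1} F = Δ^k (ΔF)`. [folklore] -/
theorem fwdDiff_succ' (h : ℝ) (k : ℕ) (F : ℝ → E) (y : ℝ) :
    fwdDiff h (k + 1) F y = fwdDiff h k (fun u ↦ F (u + h) - F u) y := by
  induction k generalizing y with
  | zero => rfl
  | succ k ih => rw [fwdDiff_succ, ih, ih, ← fwdDiff_succ]

/-- `Δ^k` is additive. [folklore] -/
theorem fwdDiff_sub (h : ℝ) (k : ℕ) (F G : ℝ → E) (y : ℝ) :
    fwdDiff h k (fun u ↦ F u - G u) y = fwdDiff h k F y - fwdDiff h k G y := by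
  induction k generalizing y with
  | zero => rfl
  | succ k ih => simp only [fwdDiff_succ, ih]; abel

/-- `Δ^k (c • F) = c • Δ^k F` for a complex scalar. [folklore] -/
theorem fwdDiff_const_mul (h : ℝ) (k : ℕ) (c : ℂ) (F : ℝ → ℂ) (y : ℝ) :
    fwdDiff h k (fun u ↦ c * F u) y = c * fwdDiff h k F y := by
  induction k generalizing y with
  | zero => rfl
  | succ k ih => simp only [fwdDiff_succ, ih]; ring

/-- `Δ^k F(y)` only depends on `F` on `[y, ∞)` (for `h ≥ 0`). [folklore] -/
theorem fwdDiff_congr {h : ℝ} (hh : 0 ≤ h) (k : ℕ) {F G : ℝ → E} {y : ℝ}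
    (hFG : ∀ u, y ≤ u → F u = G u) : fwdDiff h k F y = fwdDiff h k G y := by
  induction k generalizing y with
  | zero => exact hFG y le_rfl
  | succ k ih =>
    rw [fwdDiff_succ, fwdDiff_succ, ih (fun u hu ↦ hFG u (by linarith)), ih hFG]

/-- `‖Δ^k F(y)‖ ≤ 2^k M` if `‖F‖ ≤ M` on `[y, y + kh]` (`h ≥ 0`). [folklore] -/
theorem norm_fwdDiff_le {h : ℝ} (hh : 0 ≤ h) (k : ℕ) {F : ℝ → E} {y M : ℝ}
    (hM : ∀ u, y ≤ u → u ≤ y + k * h → ‖F u‖ ≤ M) : ‖fwdDiff h k F y‖ ≤ 2 ^ k * M := by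
  induction k generalizing y with
  | zero => simpa using hM y le_rfl (by simp)
  | succ k ih =>
    rw [fwdDiff_succ]
    have h1 : ‖fwdDiff h k F (y + h)‖ ≤ 2 ^ k * M :=
      ih fun u hu1 hu2 ↦ hM u (by linarith) (by push_cast at hu2 ⊢; linarith)
    have h2 : ‖fwdDiff h k F y‖ ≤ 2 ^ k * M :=
      ih fun u hu1 hu2 ↦ hM u hu1 (by push_cast at hu2 ⊢; nlinarith)
    calc ‖fwdDiff h k F (y + h) - fwdDiff h k F y‖ ≤ 2 ^ k * M + 2 ^ k * M :=
          (norm_sub_le _ _).trans (add_le_add h1 h2)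
      _ = 2 ^ (k + 1) * M := by ring

/-- `Δ^k` of a continuous function is continuous. [folklore] -/
theorem continuous_fwdDiff (h : ℝ) (k : ℕ) {F : ℝ → E} (hF : Continuous F) :
    Continuous (fwdDiff h k F) := by
  induction k with
  | zero => exact hF
  | succ k ih => exact (ih.comp (continuous_add_const h)).sub ih

/-- The interval integral over `[0, h]` commutes with `Δ^k` (for continuous `F`). [folklore] -/
theorem integral_fwdDiff [NormedSpace ℝ E] [CompleteSpace E] (h : ℝ) (k : ℕ) {F : ℝ → E}
    (hF : Continuous F) (y : ℝ) :
    ∫ t in (0 : ℝ)..h, fwdDiff h k F (y + t) =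
      fwdDiff h k (fun u ↦ ∫ t in (0 : ℝ)..h, F (u + t)) y := by
  induction k generalizing y with
  | zero => rfl
  | succ k ih =>
    simp only [fwdDiff_succ]
    have hc := continuous_fwdDiff h k hF
    have i1 : IntervalIntegrable (fun t : ℝ ↦ fwdDiff h k F (y + t + h)) volume 0 h :=
      (hc.comp (by fun_prop)).intervalIntegrable _ _
    have i2 : IntervalIntegrable (fun t : ℝ ↦ fwdDiff h k F (y + t)) volume 0 h :=
      (hc.comp (by fun_prop)).intervalIntegrable _ _
    rw [intervalIntegral.integral_sub i1 i2]
    have e1 : ∫ t in (0 : ℝ)..h, fwdDiff h k F (y + t + h) = ∫ t in (0 : ℝ)..h, fwdDiff h k F (y + h + t) := by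
      congr 1; ext t; ring_nf
    rw [e1, ih, ih]

/-! ### The power functions and their shifted integrals -/

/-- `u ↦ u^s` as a complex-valued function of a real variable. [folklore] -/
def cpowFn (s : ℂ) : ℝ → ℂ := fun u ↦ ((u : ℝ) : ℂ) ^ s

/-- Auxiliary step (elementary consequence of the definitions and the standing hypotheses). [folklore] -/
theorem continuous_cpowFn {s : ℂ} (hs : 0 < s.re) : Continuous (cpowFn s) :=
  Complex.continuous_ofReal_cpow_const hs

/-- `∫_0^h (y+t)^s dt = ((y+h)^{s+1} − y^{s+1})/(s+1)` for `y > 0`, `h ≥ 0`, `Re s > −1`. [folklore] -/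
theorem integral_cpowFn_shift {s : ℂ} (hs : -1 < s.re) (y h : ℝ) :
    ∫ t in (0 : ℝ)..h, cpowFn s (y + t) =
      (cpowFn (s + 1) (y + h) - cpowFn (s + 1) y) / (s + 1) := by
  unfold cpowFn
  rw [intervalIntegral.integral_comp_add_left (fun t : ℝ ↦ ((t : ℝ) : ℂ) ^ s) y, add_zero]
  rw [integral_cpow (Or.inl hs)]

/-- Auxiliary step (elementary consequence of the definitions and the standing hypotheses). [folklore] -/
theorem norm_cpowFn_of_pos (s : ℂ) {u : ℝ} (hu : 0 < u) : ‖cpowFn s u‖ = u ^ s.re :=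
  Complex.norm_cpow_eq_rpow_re_of_pos hu s

/-! ### The smoothed power differences `G_n(ρ, y)` -/

/-- `G_n(ρ, y) = Δ^{n+1}[u^{ρ+n+1}](y) / ∏_{i<n} (ρ + i + 2)`; equivalently
`G_0(ρ,y) = (y+h)^{ρ+1} − y^{ρ+1}` and `G_{n+1}(ρ, y) = ∫_0^h G_n(ρ, y+t) dt`, i.e.
`G_n(ρ, y) = (ρ+1) ∫_{[0,h]^{n+1}} (y + t_1 + ⋯ + t_{n+1})^ρ dt`. [cite: RosserSchoenfeld1975, Lemma 8] -/
def G (h : ℝ) (n : ℕ) (ρ : ℂ) (y : ℝ) : ℂ :=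
  fwdDiff h (n + 1) (cpowFn (ρ + ((n : ℂ) + 1))) y / ∏ i ∈ Finset.range n, (ρ + ((i : ℂ) + 2))

/-- Auxiliary step (elementary consequence of the definitions and the standing hypotheses). [folklore] -/
theorem prod_ne_zero {ρ : ℂ} (hρ : 0 < ρ.re) (n : ℕ) :
    ∏ i ∈ Finset.range n, (ρ + ((i : ℂ) + 2)) ≠ 0 := by
  refine Finset.prod_ne_zero_iff.2 fun i _ h0 ↦ ?_
  have := congrArg Complex.re h0
  simp at this
  linarith

/-- Auxiliary step (elementary consequence of the definitions and the standing hypotheses). [folklore] -/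
theorem G_zero (h : ℝ) (ρ : ℂ) (y : ℝ) : G h 0 ρ y = cpowFn (ρ + 1) (y + h) - cpowFn (ρ + 1) y := by
  simp [G, fwdDiff_succ, cpowFn]

/-- Auxiliary step (elementary consequence of the definitions and the standing hypotheses). [folklore] -/
theorem continuous_G (h : ℝ) (n : ℕ) {ρ : ℂ} (hρ : 0 < ρ.re) : Continuous (G h n ρ) := by
  unfold G
  refine (continuous_fwdDiff h (n + 1) (continuous_cpowFn ?_)).div_const _
  simp only [Complex.add_re, Complex.natCast_re, Complex.one_re]
  linarith

/-- The recursion `G_{n+1}(ρ, y) = ∫_0^h G_n(ρ, y + t) dt`. [cite: RosserSchoenfeld1975, Lemma 8] -/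
theorem G_succ (h : ℝ) (n : ℕ) {ρ : ℂ} (hρ : 0 < ρ.re) (y : ℝ) :
    G h (n + 1) ρ y = ∫ t in (0 : ℝ)..h, G h n ρ (y + t) := by
  have hs : 0 < (ρ + ((n : ℂ) + 1)).re := by
    simp only [Complex.add_re, Complex.natCast_re, Complex.one_re]; linarith
  have hs' : -1 < (ρ + ((n : ℂ) + 1)).re := by linarith
  set P := ∏ i ∈ Finset.range n, (ρ + ((i : ℂ) + 2)) with hP
  have hP0 : P ≠ 0 := prod_ne_zero hρ n
  have hs1 : ρ + ((n : ℂ) + 1) + 1 ≠ 0 := by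
    intro h0; have := congrArg Complex.re h0; simp at this; linarith
  -- unfold the right-hand side
  have e1 : (fun t ↦ G h n ρ (y + t)) = fun t ↦ fwdDiff h (n + 1) (cpowFn (ρ + ((n : ℂ) + 1))) (y + t) / P := by
    ext t; rfl
  rw [e1, intervalIntegral.integral_div, integral_fwdDiff h (n + 1) (continuous_cpowFn hs)]
  have e2 : (fun u ↦ ∫ t in (0 : ℝ)..h, cpowFn (ρ + ((n : ℂ) + 1)) (u + t)) =
      fun u ↦ (1 / (ρ + ((n : ℂ) + 1) + 1)) *
        (cpowFn (ρ + ((n : ℂ) + 1) + 1) (u + h) - cpowFn (ρ + ((n : ℂ) + 1) + 1) u) := by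
    ext u; rw [integral_cpowFn_shift hs']; field_simp
  rw [e2, fwdDiff_const_mul, ← fwdDiff_succ']
  -- compare with the definition of `G (n+1)`
  have e3 : ρ + (((n + 1 : ℕ) : ℂ) + 1) = ρ + ((n : ℂ) + 1) + 1 := by push_cast; ring
  rw [G, e3, Finset.prod_range_succ, ← hP]
  have e4 : ρ + ((n : ℂ) + 2) = ρ + ((n : ℂ) + 1) + 1 := by ring
  rw [e4]
  field_simp

/-- **High zeros**: `‖G_n(ρ, y)‖ ≤ 2^{n+1} (y + (n+1)h)^{Re ρ + n + 1} / ∏_{i<n} |ρ + i + 2|`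
(`y > 0`, `h ≥ 0`, `Re ρ > 0`). [cite: RosserSchoenfeld1975, Lemma 8] -/
theorem norm_G_le_high {h : ℝ} (hh : 0 ≤ h) (n : ℕ) {ρ : ℂ} (hρ : 0 < ρ.re) {y : ℝ} (hy : 0 < y) :
    ‖G h n ρ y‖ ≤ 2 ^ (n + 1) * (y + (n + 1) * h) ^ (ρ.re + n + 1) /
      ∏ i ∈ Finset.range n, ‖ρ + ((i : ℂ) + 2)‖ := by
  rw [G, norm_div, Complex.norm_prod]
  refine div_le_div_of_nonneg_right ?_ (Finset.prod_nonneg fun i _ ↦ norm_nonneg _)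
  have hs : (ρ + ((n : ℂ) + 1)).re = ρ.re + n + 1 := by
    simp only [Complex.add_re, Complex.natCast_re, Complex.one_re]; ring
  refine norm_fwdDiff_le hh (n + 1) fun u hu1 hu2 ↦ ?_
  have hu0 : 0 < u := hy.trans_le hu1
  rw [norm_cpowFn_of_pos _ hu0, hs]
  push_cast at hu2
  exact Real.rpow_le_rpow hu0.le hu2 (by linarith)

/-- **Low zeros**: `‖G_n(ρ, y)‖ ≤ |ρ + 1| h^{n+1} (y + (n+1)h)^{Re ρ}` (`y > 0`, `h ≥ 0`, `Re ρ > 0`):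
`G_n(ρ,y) = (ρ+1)∫_{[0,h]^{n+1}} (y + ∑ t_i)^ρ`. [cite: RosserSchoenfeld1975, Lemma 8] -/
theorem norm_G_le_low {h : ℝ} (hh : 0 ≤ h) (n : ℕ) {ρ : ℂ} (hρ : 0 < ρ.re) :
    ∀ {y : ℝ}, 0 < y → ‖G h n ρ y‖ ≤ ‖ρ + 1‖ * h ^ (n + 1) * (y + (n + 1) * h) ^ ρ.re := by
  induction n with
  | zero =>
    intro y hy
    have hρ1 : ρ + 1 ≠ 0 := by
      intro h0; have := congrArg Complex.re h0; simp at this; linarith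
    have hint := integral_cpowFn_shift (s := ρ) (by linarith) y h
    have e : G h 0 ρ y = (ρ + 1) * ∫ t in (0 : ℝ)..h, cpowFn ρ (y + t) := by
      rw [G_zero, hint]; field_simp
    rw [e, norm_mul]
    have hb : ‖∫ t in (0 : ℝ)..h, cpowFn ρ (y + t)‖ ≤ (y + h) ^ ρ.re * |h - 0| := by
      refine intervalIntegral.norm_integral_le_of_norm_le_const fun t ht ↦ ?_
      rw [Set.uIoc_of_le hh] at ht
      have ht0 : 0 < y + t := by linarith [ht.1]
      rw [norm_cpowFn_of_pos _ ht0]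
      exact Real.rpow_le_rpow ht0.le (by linarith [ht.2]) hρ.le
    rw [sub_zero, abs_of_nonneg hh] at hb
    refine (mul_le_mul_of_nonneg_left hb (norm_nonneg _)).trans (le_of_eq ?_)
    push_cast
    ring_nf
  | succ n ih =>
    intro y hy
    rw [G_succ h n hρ y]
    have hb : ‖∫ t in (0 : ℝ)..h, G h n ρ (y + t)‖ ≤
        ‖ρ + 1‖ * h ^ (n + 1) * (y + (n + 2) * h) ^ ρ.re * |h - 0| := by
      refine intervalIntegral.norm_integral_le_of_norm_le_const fun t ht ↦ ?_
      rw [Set.uIoc_of_le hh] at ht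
      have ht0 : 0 < y + t := by linarith [ht.1]
      refine (ih ht0).trans ?_
      refine mul_le_mul_of_nonneg_left ?_ (by positivity)
      exact Real.rpow_le_rpow (by positivity) (by nlinarith [ht.2]) hρ.le
    rw [sub_zero, abs_of_nonneg hh] at hb
    refine hb.trans (le_of_eq ?_)
    push_cast
    ring

/-! ### The differenced zero sum and its iterated averages -/

open NicolasJExplicit NicolasJ SchoenfeldBound

/-- `c(ρ) = m(ρ)/(ρ(ρ+1))`, so that `zeroTerm ρ t = c(ρ) t^{ρ+1}`. [cite: MontgomeryVaughan2007, (13.7)] -/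
def coef (ρ : Zeros) : ℂ := (riemannZetaZeroOrder (ρ : ℂ) : ℂ) / ((ρ : ℂ) * (ρ + 1))

/-- Auxiliary step (elementary consequence of the definitions and the standing hypotheses). [folklore] -/
theorem zeroTerm_eq (ρ : Zeros) (t : ℝ) : zeroTerm ρ t = coef ρ * cpowFn ((ρ : ℂ) + 1) t := by
  simp only [zeroTerm, coef, cpowFn]; ring

/-- Auxiliary step (elementary consequence of the definitions and the standing hypotheses). [folklore] -/
theorem norm_coef (ρ : Zeros) :
    ‖coef ρ‖ = (riemannZetaZeroOrder (ρ : ℂ) : ℝ) / (‖(ρ : ℂ)‖ * ‖(ρ : ℂ) + 1‖) := by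
  rw [coef, norm_div, norm_mul, Complex.norm_intCast, abs_of_nonneg (zeroOrder_nonneg' ρ)]

/-- Auxiliary step (elementary consequence of the definitions and the standing hypotheses). [folklore] -/
theorem norm_coef_eq_norm_zeroTerm_one (ρ : Zeros) : ‖coef ρ‖ = ‖zeroTerm ρ 1‖ := by
  rw [zeroTerm_eq, norm_mul, cpowFn, Complex.ofReal_one, Complex.one_cpow, norm_one, mul_one]

/-- Auxiliary step (elementary consequence of the definitions and the standing hypotheses). [folklore] -/
theorem re_pos' (ρ : Zeros) : 0 < ((ρ : ℂ)).re := re_pos ρ.2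

/-- The terms `c(ρ) G_n(ρ, y)` of the `n`-fold averaged differenced zero sum. [cite: RosserSchoenfeld1975, Lemma 8] -/
def term (h : ℝ) (n : ℕ) (ρ : Zeros) (y : ℝ) : ℂ := coef ρ * G h n (ρ : ℂ) y

/-- `A_0(y) = Z(y+h) − Z(y)`, `A_{n+1}(y) = ∫_0^h A_n(y+t) dt`. [cite: RosserSchoenfeld1975, Lemma 8] -/
def A (h : ℝ) : ℕ → ℝ → ℂ
  | 0 => fun y ↦ Zsum (y + h) - Zsum y
  | n + 1 => fun y ↦ ∫ t in (0 : ℝ)..h, A h n (y + t)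

/-- Auxiliary step (elementary consequence of the definitions and the standing hypotheses). [folklore] -/
theorem A_succ (h : ℝ) (n : ℕ) (y : ℝ) : A h (n + 1) y = ∫ t in (0 : ℝ)..h, A h n (y + t) := rfl

/-- Auxiliary step (elementary consequence of the definitions and the standing hypotheses). [folklore] -/
theorem continuous_term (h : ℝ) (n : ℕ) (ρ : Zeros) : Continuous (term h n ρ) :=
  continuous_const.mul (continuous_G h n (re_pos' ρ))

/-- Uniform domination on `[1, X]`: `‖c(ρ) G_n(ρ, y)‖ ≤ 2^{n+1}(X + (n+1)h)^{n+2} ‖zeroTerm ρ 1‖`. [folklore] -/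
theorem norm_term_le {h : ℝ} (hh : 0 ≤ h) (n : ℕ) (ρ : Zeros) {y X : ℝ} (hy : 1 ≤ y) (hyX : y ≤ X) :
    ‖term h n ρ y‖ ≤ (2 ^ (n + 1) * (X + (n + 1) * h) ^ ((n : ℝ) + 2)) * ‖zeroTerm ρ 1‖ := by
  have hβ0 := re_pos' ρ
  have hβ1 := re_lt_one ρ.2
  have hy0 : 0 < y := by linarith
  rw [term, norm_mul, norm_coef_eq_norm_zeroTerm_one, mul_comm]
  refine mul_le_mul_of_nonneg_right ?_ (norm_nonneg _)
  refine (norm_G_le_high hh n hβ0 hy0).trans ?_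
  have hprod : 1 ≤ ∏ i ∈ Finset.range n, ‖(ρ : ℂ) + ((i : ℂ) + 2)‖ := by
    refine Finset.one_le_prod fun i _ ↦ ?_
    have h1 : ((ρ : ℂ) + ((i : ℂ) + 2)).re ≤ ‖(ρ : ℂ) + ((i : ℂ) + 2)‖ := Complex.re_le_norm _
    have h2 : ((ρ : ℂ) + ((i : ℂ) + 2)).re = ((ρ : ℂ)).re + i + 2 := by simp; ring
    rw [h2] at h1
    linarith [(i.cast_nonneg : (0 : ℝ) ≤ i)]
  have hY1 : 1 ≤ y + (n + 1) * h := by nlinarith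
  calc 2 ^ (n + 1) * (y + (n + 1) * h) ^ (((ρ : ℂ)).re + n + 1) / ∏ i ∈ Finset.range n, ‖(ρ : ℂ) + ((i : ℂ) + 2)‖
      ≤ 2 ^ (n + 1) * (y + (n + 1) * h) ^ (((ρ : ℂ)).re + n + 1) := div_le_self (by positivity) hprod
    _ ≤ 2 ^ (n + 1) * (X + (n + 1) * h) ^ ((n : ℝ) + 2) := by
        refine mul_le_mul_of_nonneg_left ?_ (by positivity)
        calc (y + (n + 1) * h) ^ (((ρ : ℂ)).re + n + 1) ≤ (y + (n + 1) * h) ^ ((n : ℝ) + 2) :=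
              Real.rpow_le_rpow_of_exponent_le hY1 (by linarith)
          _ ≤ (X + (n + 1) * h) ^ ((n : ℝ) + 2) :=
              Real.rpow_le_rpow (by linarith) (by linarith) (by positivity)

/-- **`∑_ρ c(ρ) G_n(ρ, y) = A_n(y)`** for `y ≥ 1` (termwise integration, dominated convergence).
[cite: RosserSchoenfeld1975, Lemma 8] -/
theorem hasSum_term {h : ℝ} (hh : 0 ≤ h) :
    ∀ (n : ℕ) {y : ℝ}, 1 ≤ y → HasSum (fun ρ : Zeros ↦ term h n ρ y) (A h n y) := by
  intro n
  induction n with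
  | zero =>
    intro y hy
    have hy' : 1 ≤ y + h := by linarith
    have h1 := (summable_zeroTerm hy').hasSum
    have h2 := (summable_zeroTerm hy).hasSum
    have h3 := h1.sub h2
    have e : (fun ρ : Zeros ↦ zeroTerm ρ (y + h) - zeroTerm ρ y) = fun ρ ↦ term h 0 ρ y := by
      ext ρ; rw [term, G_zero, zeroTerm_eq, zeroTerm_eq]; ring
    rw [e] at h3
    exact h3
  | succ n ih =>
    intro y hy
    set C : ℝ := 2 ^ (n + 1) * ((y + h) + (n + 1) * h) ^ ((n : ℝ) + 2) with hC
    have hsum : Summable fun ρ : Zeros ↦ C * ‖zeroTerm ρ 1‖ :=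
      (summable_norm_psiOne_zeroTerm le_rfl).mul_left C
    have key := intervalIntegral.hasSum_integral_of_dominated_convergence
      (μ := volume) (a := (0 : ℝ)) (b := h) (F := fun (ρ : Zeros) (t : ℝ) ↦ term h n ρ (y + t))
      (f := fun t ↦ A h n (y + t)) (fun ρ _ ↦ C * ‖zeroTerm ρ 1‖)
      (fun ρ ↦ ((continuous_term h n ρ).comp (by fun_prop)).aestronglyMeasurable)
      (fun ρ ↦ ae_of_all _ fun t ht ↦ by
        rw [Set.uIoc_of_le hh] at ht
        exact norm_term_le hh n ρ (by linarith [ht.1]) (by linarith [ht.2]))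
      (ae_of_all _ fun t _ ↦ hsum)
      intervalIntegrable_const
      (ae_of_all _ fun t ht ↦ by
        rw [Set.uIoc_of_le hh] at ht
        exact ih (by linarith [ht.1]))
    have e : (fun ρ : Zeros ↦ ∫ t in (0 : ℝ)..h, term h n ρ (y + t)) = fun ρ ↦ term h (n + 1) ρ y := by
      ext ρ
      simp only [term]
      rw [intervalIntegral.integral_const_mul, G_succ h n (re_pos' ρ)]
    rw [e] at key
    exact key

/-- `A_n` is continuous on `[1, ∞)`. [folklore] -/
theorem continuousOn_A {h : ℝ} (hh : 0 ≤ h) (n : ℕ) : ContinuousOn (A h n) (Ici 1) := by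
  have hIcc : ∀ X : ℝ, ContinuousOn (A h n) (Icc 1 X) := by
    intro X
    have hu : Summable fun ρ : Zeros ↦ (2 ^ (n + 1) * (X + (n + 1) * h) ^ ((n : ℝ) + 2)) * ‖zeroTerm ρ 1‖ :=
      (summable_norm_psiOne_zeroTerm le_rfl).mul_left _
    have hc := continuousOn_tsum (fun ρ ↦ (continuous_term h n ρ).continuousOn) hu
      fun ρ y (hy : y ∈ Icc 1 X) ↦ norm_term_le hh n ρ hy.1 hy.2
    refine hc.congr fun y hy ↦ ?_
    exact ((hasSum_term hh n hy.1).tsum_eq).symm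
  intro t ht
  have h1 : ContinuousWithinAt (A h n) (Icc 1 (t + 1)) t := hIcc (t + 1) t ⟨ht, by linarith⟩
  refine h1.mono_of_mem_nhdsWithin ?_
  have : Iio (t + 1) ∈ 𝓝 t := Iio_mem_nhds (by linarith)
  filter_upwards [self_mem_nhdsWithin, mem_nhdsWithin_of_mem_nhds this] with s hs hs'
  exact ⟨hs, hs'.le⟩

/-! ### The tail sums `∑_{|Im ρ| > T} m(ρ)/|Im ρ|^p` and the bound for `A_n` -/

/-- `tailPow p T = ∑_{|Im ρ| > T} m(ρ)/|Im ρ|^p` (zeros with `|Im ρ| ≤ T` omitted). [cite: RosserSchoenfeld1975, Lemma 8] -/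
def tailPow (p : ℕ) (T : ℝ) : ℝ :=
  ∑' ρ : Zeros, if ρ ∈ zerosUpTo T then 0 else (riemannZetaZeroOrder (ρ : ℂ) : ℝ) / |((ρ : ℂ)).im| ^ p

/-- Auxiliary step (elementary consequence of the definitions and the standing hypotheses). [folklore] -/
theorem tailPow_term_nonneg (p : ℕ) (T : ℝ) (ρ : Zeros) :
    0 ≤ (if ρ ∈ zerosUpTo T then 0 else (riemannZetaZeroOrder (ρ : ℂ) : ℝ) / |((ρ : ℂ)).im| ^ p) := by
  split_ifs
  · exact le_rfl
  · exact div_nonneg (zeroOrder_nonneg' ρ) (by positivity)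

/-- Auxiliary step (elementary consequence of the definitions and the standing hypotheses). [folklore] -/
theorem abs_im_gt_of_not_mem {T : ℝ} {ρ : Zeros} (hρ : ρ ∉ zerosUpTo T) : T < |((ρ : ℂ)).im| := by
  rw [mem_zerosUpTo] at hρ; exact lt_of_not_ge hρ

/-- Auxiliary step (elementary consequence of the definitions and the standing hypotheses). [folklore] -/
theorem norm_le_two_mul_abs_im {ρ : Zeros} (h1 : 1 ≤ |((ρ : ℂ)).im|) : ‖(ρ : ℂ)‖ ≤ 2 * |((ρ : ℂ)).im| := by
  have h := Complex.norm_le_abs_re_add_abs_im (ρ : ℂ)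
  have hre : |((ρ : ℂ)).re| ≤ 1 := by
    rw [abs_le]; constructor <;> linarith [re_pos' ρ, re_lt_one ρ.2]
  linarith

/-- Auxiliary step (elementary consequence of the definitions and the standing hypotheses). [folklore] -/
theorem norm_add_one_le_three_mul_abs_im {ρ : Zeros} (h1 : 1 ≤ |((ρ : ℂ)).im|) :
    ‖(ρ : ℂ) + 1‖ ≤ 3 * |((ρ : ℂ)).im| := by
  have h := norm_add_le (ρ : ℂ) 1
  rw [norm_one] at h
  linarith [norm_le_two_mul_abs_im h1]

/-- The tail sums converge (`p ≥ 2`, `T ≥ 1`): each term is at most `6 ‖zeroTerm ρ 1‖`. [folklore] -/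
theorem summable_tailPow {p : ℕ} (hp : 2 ≤ p) {T : ℝ} (hT : 1 ≤ T) :
    Summable fun ρ : Zeros ↦
      (if ρ ∈ zerosUpTo T then 0 else (riemannZetaZeroOrder (ρ : ℂ) : ℝ) / |((ρ : ℂ)).im| ^ p) := by
  refine Summable.of_nonneg_of_le (tailPow_term_nonneg p T) (fun ρ ↦ ?_)
    ((summable_norm_psiOne_zeroTerm le_rfl).mul_left 6)
  split_ifs with hρ
  · positivity
  · have hγ : 1 ≤ |((ρ : ℂ)).im| := hT.trans (abs_im_gt_of_not_mem hρ).le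
    have hγ0 : 0 < |((ρ : ℂ)).im| := by linarith
    have hm := zeroOrder_nonneg' ρ
    change (riemannZetaZeroOrder (ρ : ℂ) : ℝ) / |((ρ : ℂ)).im| ^ p ≤ 6 * ‖zeroTerm ρ 1‖
    rw [← norm_coef_eq_norm_zeroTerm_one, norm_coef]
    have hρ0 : 0 < ‖(ρ : ℂ)‖ := norm_pos_iff.2 (ne_zero ρ.2)
    have hρ1 : 0 < ‖(ρ : ℂ) + 1‖ := norm_pos_iff.2 (add_one_ne_zero ρ.2)
    have hden : ‖(ρ : ℂ)‖ * ‖(ρ : ℂ) + 1‖ ≤ 6 * |((ρ : ℂ)).im| ^ 2 := by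
      calc ‖(ρ : ℂ)‖ * ‖(ρ : ℂ) + 1‖ ≤ (2 * |((ρ : ℂ)).im|) * (3 * |((ρ : ℂ)).im|) :=
            mul_le_mul (norm_le_two_mul_abs_im hγ) (norm_add_one_le_three_mul_abs_im hγ) hρ1.le (by positivity)
        _ = 6 * |((ρ : ℂ)).im| ^ 2 := by ring
    have hpow : |((ρ : ℂ)).im| ^ 2 ≤ |((ρ : ℂ)).im| ^ p := pow_le_pow_right₀ hγ hp
    calc (riemannZetaZeroOrder (ρ : ℂ) : ℝ) / |((ρ : ℂ)).im| ^ p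
        ≤ (riemannZetaZeroOrder (ρ : ℂ) : ℝ) / |((ρ : ℂ)).im| ^ 2 :=
          div_le_div_of_nonneg_left hm (by positivity) hpow
      _ ≤ (riemannZetaZeroOrder (ρ : ℂ) : ℝ) / (‖(ρ : ℂ)‖ * ‖(ρ : ℂ) + 1‖ / 6) :=
          div_le_div_of_nonneg_left hm (by positivity) (by linarith)
      _ = 6 * ((riemannZetaZeroOrder (ρ : ℂ) : ℝ) / (‖(ρ : ℂ)‖ * ‖(ρ : ℂ) + 1‖)) := by
          field_simp

/-- Auxiliary step (elementary consequence of the definitions and the standing hypotheses). [folklore] -/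
theorem tailPow_nonneg (p : ℕ) (T : ℝ) : 0 ≤ tailPow p T :=
  tsum_nonneg (tailPow_term_nonneg p T)

/-- Auxiliary step (elementary consequence of the definitions and the standing hypotheses). [folklore] -/
theorem hasSum_tailPow {p : ℕ} (hp : 2 ≤ p) {T : ℝ} (hT : 1 ≤ T) :
    HasSum (fun ρ : Zeros ↦
      (if ρ ∈ zerosUpTo T then 0 else (riemannZetaZeroOrder (ρ : ℂ) : ℝ) / |((ρ : ℂ)).im| ^ p))
      (tailPow p T) :=
  (summable_tailPow hp hT).hasSum

/-- `|Im ρ|^{n+2} ≤ |ρ| |ρ+1| ∏_{i<n} |ρ + i + 2|`. [folklore] -/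
theorem abs_im_pow_le_prod (ρ : Zeros) (n : ℕ) :
    |((ρ : ℂ)).im| ^ (n + 2) ≤
      ‖(ρ : ℂ)‖ * ‖(ρ : ℂ) + 1‖ * ∏ i ∈ Finset.range n, ‖(ρ : ℂ) + ((i : ℂ) + 2)‖ := by
  have h0 : 0 ≤ |((ρ : ℂ)).im| := abs_nonneg _
  have h1 : |((ρ : ℂ)).im| ≤ ‖(ρ : ℂ)‖ := Complex.abs_im_le_norm _
  have h2 : |((ρ : ℂ)).im| ≤ ‖(ρ : ℂ) + 1‖ := by
    have := Complex.abs_im_le_norm ((ρ : ℂ) + 1); simpa using this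
  have h3 : |((ρ : ℂ)).im| ^ n ≤ ∏ i ∈ Finset.range n, ‖(ρ : ℂ) + ((i : ℂ) + 2)‖ := by
    have e : |((ρ : ℂ)).im| ^ n = ∏ _i ∈ Finset.range n, |((ρ : ℂ)).im| := by
      rw [Finset.prod_const, Finset.card_range]
    rw [e]
    refine Finset.prod_le_prod (fun i _ ↦ h0) fun i _ ↦ ?_
    have := Complex.abs_im_le_norm ((ρ : ℂ) + ((i : ℂ) + 2)); simpa using this
  calc |((ρ : ℂ)).im| ^ (n + 2) = |((ρ : ℂ)).im| * |((ρ : ℂ)).im| * |((ρ : ℂ)).im| ^ n := by ring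
    _ ≤ ‖(ρ : ℂ)‖ * ‖(ρ : ℂ) + 1‖ * ∏ i ∈ Finset.range n, ‖(ρ : ℂ) + ((i : ℂ) + 2)‖ := by
        gcongr

/-- **The split bound for `A_n`**: if every zero with `|Im ρ| ≤ T` has real part `1/2`, then for
`y ≥ 1`, `h > 0`, with `Y = y + (n+1)h`,
`‖A_n(y)‖ ≤ h^{n+1} √Y · sumInvNorm T + 2^{n+1} Y^{n+2} · tailPow (n+2) T`
(low zeros: `|c(ρ)G_n| ≤ h^{n+1}√Y m/|ρ|`; high zeros: `|c(ρ)G_n| ≤ 2^{n+1}Y^{n+2} m/|Im ρ|^{n+2}`).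
[cite: RosserSchoenfeld1975, Lemma 8] -/
theorem norm_A_le {h : ℝ} (hh : 0 < h) (n : ℕ) {T : ℝ} (hT : 1 ≤ T)
    (hhalf : ∀ ρ ∈ zerosUpTo T, ((ρ : ℂ)).re = 1 / 2) {y : ℝ} (hy : 1 ≤ y) :
    ‖A h n y‖ ≤ h ^ (n + 1) * Real.sqrt (y + (n + 1) * h) * sumInvNorm T +
      2 ^ (n + 1) * (y + (n + 1) * h) ^ ((n : ℝ) + 2) * tailPow (n + 2) T := by
  classical
  have hy0 : 0 < y := by linarith
  set Y : ℝ := y + (n + 1) * h with hY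
  have hY1 : 1 ≤ Y := by rw [hY]; nlinarith
  have hY0 : 0 < Y := by linarith
  set S := zerosUpTo T with hS
  set g₁ : Zeros → ℝ := fun ρ ↦ if ρ ∈ S then
      h ^ (n + 1) * Real.sqrt Y * ((riemannZetaZeroOrder (ρ : ℂ) : ℝ) / ‖(ρ : ℂ)‖) else 0 with hg₁
  set g₂ : Zeros → ℝ := fun ρ ↦ 2 ^ (n + 1) * Y ^ ((n : ℝ) + 2) *
      (if ρ ∈ S then 0 else (riemannZetaZeroOrder (ρ : ℂ) : ℝ) / |((ρ : ℂ)).im| ^ (n + 2)) with hg₂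
  have h₁ : HasSum g₁ (h ^ (n + 1) * Real.sqrt Y * sumInvNorm T) := by
    have hfin : HasSum g₁ (∑ ρ ∈ S, g₁ ρ) :=
      hasSum_sum_of_ne_finset_zero (fun ρ hρ ↦ by simp only [hg₁]; rw [if_neg hρ])
    have hs : ∑ ρ ∈ S, g₁ ρ = h ^ (n + 1) * Real.sqrt Y * sumInvNorm T := by
      rw [sumInvNorm, ← hS, Finset.mul_sum]
      refine Finset.sum_congr rfl fun ρ hρ ↦ ?_
      simp only [hg₁]; rw [if_pos hρ]
    rwa [hs] at hfin
  have h₂ : HasSum g₂ (2 ^ (n + 1) * Y ^ ((n : ℝ) + 2) * tailPow (n + 2) T) :=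
    (hasSum_tailPow (by omega) hT).mul_left _
  have hmaj : ∀ ρ : Zeros, ‖term h n ρ y‖ ≤ g₁ ρ + g₂ ρ := by
    intro ρ
    have hm := zeroOrder_nonneg' ρ
    have hρ0 : 0 < ‖(ρ : ℂ)‖ := norm_pos_iff.2 (ne_zero ρ.2)
    have hρ1 : 0 < ‖(ρ : ℂ) + 1‖ := norm_pos_iff.2 (add_one_ne_zero ρ.2)
    have hβ0 := re_pos' ρ
    have hβ1 := re_lt_one ρ.2
    rw [term, norm_mul, norm_coef]
    by_cases hρ : ρ ∈ S
    · simp only [hg₁, hg₂]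
      rw [if_pos hρ, if_pos hρ, mul_zero, add_zero]
      have hG := norm_G_le_low hh.le n hβ0 hy0
      rw [hhalf ρ hρ, ← hY, ← Real.sqrt_eq_rpow] at hG
      calc (riemannZetaZeroOrder (ρ : ℂ) : ℝ) / (‖(ρ : ℂ)‖ * ‖(ρ : ℂ) + 1‖) * ‖G h n (ρ : ℂ) y‖
          ≤ (riemannZetaZeroOrder (ρ : ℂ) : ℝ) / (‖(ρ : ℂ)‖ * ‖(ρ : ℂ) + 1‖) *
              (‖(ρ : ℂ) + 1‖ * h ^ (n + 1) * Real.sqrt Y) :=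
            mul_le_mul_of_nonneg_left hG (by positivity)
        _ = h ^ (n + 1) * Real.sqrt Y * ((riemannZetaZeroOrder (ρ : ℂ) : ℝ) / ‖(ρ : ℂ)‖) := by
            field_simp
    · simp only [hg₁, hg₂]
      rw [if_neg hρ, if_neg hρ, zero_add]
      have hG := norm_G_le_high hh.le n hβ0 hy0
      rw [← hY] at hG
      have hγ : 1 ≤ |((ρ : ℂ)).im| := hT.trans (abs_im_gt_of_not_mem hρ).le
      have hγ0 : 0 < |((ρ : ℂ)).im| := by linarith
      set P := ∏ i ∈ Finset.range n, ‖(ρ : ℂ) + ((i : ℂ) + 2)‖ with hP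
      have hP0 : 0 < P := by
        rw [hP]; exact Finset.prod_pos fun i _ ↦ norm_pos_iff.2 fun h0 ↦ by
          have := congrArg Complex.re h0; simp at this; linarith
      have hprod := abs_im_pow_le_prod ρ n
      rw [← hP] at hprod
      have hYpow : Y ^ (((ρ : ℂ)).re + n + 1) ≤ Y ^ ((n : ℝ) + 2) :=
        Real.rpow_le_rpow_of_exponent_le hY1 (by linarith)
      calc (riemannZetaZeroOrder (ρ : ℂ) : ℝ) / (‖(ρ : ℂ)‖ * ‖(ρ : ℂ) + 1‖) * ‖G h n (ρ : ℂ) y‖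
          ≤ (riemannZetaZeroOrder (ρ : ℂ) : ℝ) / (‖(ρ : ℂ)‖ * ‖(ρ : ℂ) + 1‖) *
              (2 ^ (n + 1) * Y ^ (((ρ : ℂ)).re + n + 1) / P) :=
            mul_le_mul_of_nonneg_left hG (by positivity)
        _ = 2 ^ (n + 1) * Y ^ (((ρ : ℂ)).re + n + 1) *
              ((riemannZetaZeroOrder (ρ : ℂ) : ℝ) / (‖(ρ : ℂ)‖ * ‖(ρ : ℂ) + 1‖ * P)) := by
            field_simp
        _ ≤ 2 ^ (n + 1) * Y ^ ((n : ℝ) + 2) *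
              ((riemannZetaZeroOrder (ρ : ℂ) : ℝ) / |((ρ : ℂ)).im| ^ (n + 2)) := by
            refine mul_le_mul (mul_le_mul_of_nonneg_left hYpow (by positivity)) ?_ (by positivity)
              (by positivity)
            exact div_le_div_of_nonneg_left hm (by positivity) hprod
  have hb := tsum_of_norm_bounded (h₁.add h₂) hmaj
  rwa [(hasSum_term hh.le n hy).tsum_eq] at hb

/-! ### Iterated averages of real functions and the differencing inequalities for `ψ` -/

/-- `itg_0 F = F`, `itg_{n+1} F (y) = ∫_0^h itg_n F (y+t) dt` (so `itg_n F(y) = ∫_{[0,h]^n} F(y + ∑tᵢ)`).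
[cite: RosserSchoenfeld1975, Lemma 8] -/
def itg (h : ℝ) : ℕ → (ℝ → ℝ) → ℝ → ℝ
  | 0, F => F
  | n + 1, F => fun y ↦ ∫ t in (0 : ℝ)..h, itg h n F (y + t)

/-- Auxiliary step (elementary consequence of the definitions and the standing hypotheses). [folklore] -/
theorem itg_succ (h : ℝ) (n : ℕ) (F : ℝ → ℝ) (y : ℝ) :
    itg h (n + 1) F y = ∫ t in (0 : ℝ)..h, itg h n F (y + t) := rfl

/-- Auxiliary step (elementary consequence of the definitions and the standing hypotheses). [folklore] -/
theorem monotone_shift {F : ℝ → ℝ} (hF : Monotone F) (c : ℝ) : Monotone fun t : ℝ ↦ F (c + t) :=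
  fun _ _ hab ↦ hF (by linarith)

/-- `itg_n` of a monotone function is monotone (`h ≥ 0`). [folklore] -/
theorem itg_monotone {h : ℝ} (hh : 0 ≤ h) {F : ℝ → ℝ} (hF : Monotone F) : ∀ n, Monotone (itg h n F) := by
  intro n
  induction n with
  | zero => exact hF
  | succ n ih =>
    intro y y' hyy'
    simp only [itg_succ]
    refine intervalIntegral.integral_mono_on hh ?_ ?_ fun t _ ↦ ih (by linarith)
    · exact (monotone_shift ih y).intervalIntegrable
    · exact (monotone_shift ih y').intervalIntegrable

/-- The first difference `D(y) = ψ₁(y+h) − ψ₁(y)`. [cite: RosserSchoenfeld1975, Lemma 8] -/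
def D (h : ℝ) (y : ℝ) : ℝ := psiOne (y + h) - psiOne y

/-- `D` is monotone (`h ≥ 0`): `ψ₁(b) − ψ₁(a) ∈ [(b−a)ψ(a), (b−a)ψ(b)]`. [folklore] -/
theorem D_monotone {h : ℝ} (hh : 0 ≤ h) : Monotone (D h) := by
  intro y y' hyy'
  simp only [D]
  rcases le_or_gt (y + h) y' with hc | hc
  · -- `y + h ≤ y'`
    have h1 := (psiOne_sub_psiOne_bounds (show y ≤ y + h by linarith)).2
    have h2 := mul_psi_le_psiOne_sub (show y' ≤ y' + h by linarith)
    have h3 : ψ (y + h) ≤ ψ y' := Chebyshev.psi_mono hc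
    have e1 : y + h - y = h := by ring
    have e2 : y' + h - y' = h := by ring
    rw [e1] at h1; rw [e2] at h2
    nlinarith
  · -- `y' < y + h`
    have h1 := mul_psi_le_psiOne_sub (show y + h ≤ y' + h by linarith)
    have h2 := (psiOne_sub_psiOne_bounds hyy').2
    have h3 : ψ y' ≤ ψ (y + h) := Chebyshev.psi_mono hc.le
    have e1 : y' + h - (y + h) = y' - y := by ring
    rw [e1] at h1
    nlinarith

/-- **Upper differencing inequality**: `h^{n+1} ψ(y) ≤ itg_n D (y)` (`ψ` is non-decreasing).
[cite: RosserSchoenfeld1975, Lemma 8] -/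
theorem pow_mul_psi_le_itg {h : ℝ} (hh : 0 ≤ h) : ∀ (n : ℕ) (y : ℝ), h ^ (n + 1) * ψ y ≤ itg h n (D h) y := by
  intro n
  induction n with
  | zero =>
    intro y
    have := mul_psi_le_psiOne_sub (show y ≤ y + h by linarith)
    rw [show y + h - y = h by ring] at this
    simpa [itg, D] using this
  | succ n ih =>
    intro y
    rw [itg_succ]
    have hmono := itg_monotone hh (D_monotone hh) n
    calc h ^ (n + 1 + 1) * ψ y = ∫ _t in (0 : ℝ)..h, h ^ (n + 1) * ψ y := by
          rw [intervalIntegral.integral_const]; simp; ring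
      _ ≤ ∫ t in (0 : ℝ)..h, itg h n (D h) (y + t) := by
          refine intervalIntegral.integral_mono_on hh intervalIntegrable_const ?_ fun t ht ↦ ?_
          · exact (monotone_shift hmono y).intervalIntegrable
          · exact (ih y).trans (hmono (by linarith [ht.1]))

/-- **Lower differencing inequality**: `itg_n D (y − (n+1)h) ≤ h^{n+1} ψ(y)`.
[cite: RosserSchoenfeld1975, Lemma 8] -/
theorem itg_le_pow_mul_psi {h : ℝ} (hh : 0 ≤ h) :
    ∀ (n : ℕ) (y : ℝ), itg h n (D h) (y - (n + 1) * h) ≤ h ^ (n + 1) * ψ y := by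
  intro n
  induction n with
  | zero =>
    intro y
    have := (psiOne_sub_psiOne_bounds (show y - h ≤ y by linarith)).2
    rw [show y - (y - h) = h by ring] at this
    simp only [itg, D, Nat.cast_zero, zero_add, one_mul, pow_one]
    rwa [show y - h + h = y by ring]
  | succ n ih =>
    intro y
    rw [itg_succ]
    have hmono := itg_monotone hh (D_monotone hh) n
    have hψ : Monotone fun t : ℝ ↦ h ^ (n + 1) * ψ (y - h + t) :=
      fun a b hab ↦ mul_le_mul_of_nonneg_left (Chebyshev.psi_mono (by linarith)) (by positivity)
    calc ∫ t in (0 : ℝ)..h, itg h n (D h) (y - (↑(n + 1) + 1) * h + t)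
        ≤ ∫ t in (0 : ℝ)..h, h ^ (n + 1) * ψ (y - h + t) := by
          refine intervalIntegral.integral_mono_on hh ?_ hψ.intervalIntegrable fun t _ ↦ ?_
          · exact (monotone_shift hmono _).intervalIntegrable
          · have := ih (y - h + t)
            have e : y - h + t - (n + 1) * h = y - (↑(n + 1) + 1) * h + t := by push_cast; ring
            rwa [e] at this
      _ ≤ ∫ _t in (0 : ℝ)..h, h ^ (n + 1) * ψ y := by
          refine intervalIntegral.integral_mono_on hh hψ.intervalIntegrable intervalIntegrable_const
            fun t ht ↦ ?_
          exact mul_le_mul_of_nonneg_left (Chebyshev.psi_mono (by linarith [ht.2])) (by positivity)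
      _ = h ^ (n + 1 + 1) * ψ y := by rw [intervalIntegral.integral_const]; simp; ring

/-! ### Evaluating `itg_n D` by the explicit formula -/

/-- The affine main part `L(y) = h(y + h/2 − log 2π)` of `D(y)`. [cite: MontgomeryVaughan2007, (13.7)] -/
def L (h : ℝ) (y : ℝ) : ℝ := h * (y + h / 2 - Real.log (2 * π))

/-- `itg_n L (y) = h^{n+1}(y + (n+1)h/2 − log 2π)`. [folklore] -/
theorem itg_L (h : ℝ) : ∀ (n : ℕ) (y : ℝ),
    itg h n (L h) y = h ^ (n + 1) * (y + (n + 1) * h / 2 - Real.log (2 * π)) := by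
  intro n
  induction n with
  | zero => intro y; simp [itg, L]
  | succ n ih =>
    intro y
    rw [itg_succ]
    simp only [ih]
    have e : (fun t : ℝ ↦ h ^ (n + 1) * (y + t + (n + 1) * h / 2 - Real.log (2 * π))) =
        fun t : ℝ ↦ h ^ (n + 1) * (y + (n + 1) * h / 2 - Real.log (2 * π)) + h ^ (n + 1) * t := by
      ext t; ring
    have i2 : IntervalIntegrable (fun t : ℝ ↦ h ^ (n + 1) * t) volume 0 h :=
      (by fun_prop : Continuous fun t : ℝ ↦ h ^ (n + 1) * t).intervalIntegrable _ _
    rw [e, intervalIntegral.integral_add intervalIntegrable_const i2,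
      intervalIntegral.integral_const, intervalIntegral.integral_const_mul, integral_id]
    simp only [sub_zero, smul_eq_mul]
    push_cast
    ring

/-- `Φ_n(y) = itg_n L (y) − Re A_n(y)` (the explicit part of `itg_n D`). [cite: RosserSchoenfeld1975, Lemma 8] -/
def Phi (h : ℝ) (n : ℕ) (y : ℝ) : ℝ := itg h n (L h) y - (A h n y).re

/-- Auxiliary step (elementary consequence of the definitions and the standing hypotheses). [folklore] -/
theorem continuousOn_Phi {h : ℝ} (hh : 0 ≤ h) (n : ℕ) : ContinuousOn (Phi h n) (Ici 1) := by
  have h1 : Continuous fun y ↦ itg h n (L h) y := by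
    have e : (fun y ↦ itg h n (L h) y) = fun y ↦ h ^ (n + 1) * (y + (n + 1) * h / 2 - Real.log (2 * π)) := by
      ext y; exact itg_L h n y
    rw [e]; fun_prop
  exact h1.continuousOn.sub (Complex.continuous_re.comp_continuousOn (continuousOn_A hh n))

/-- Auxiliary step (elementary consequence of the definitions and the standing hypotheses). [folklore] -/
theorem intervalIntegrable_A_shift {h : ℝ} (hh : 0 ≤ h) (n : ℕ) {y : ℝ} (hy : 1 ≤ y) :
    IntervalIntegrable (fun t : ℝ ↦ A h n (y + t)) volume 0 h := by
  refine ContinuousOn.intervalIntegrable_of_Icc hh ?_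
  refine (continuousOn_A hh n).comp (by fun_prop) fun t ht ↦ ?_
  simp only [Set.mem_Ici]; linarith [ht.1]

/-- Auxiliary step (elementary consequence of the definitions and the standing hypotheses). [folklore] -/
theorem intervalIntegrable_Phi_shift {h : ℝ} (hh : 0 ≤ h) (n : ℕ) {y : ℝ} (hy : 1 ≤ y) :
    IntervalIntegrable (fun t : ℝ ↦ Phi h n (y + t)) volume 0 h := by
  refine ContinuousOn.intervalIntegrable_of_Icc hh ?_
  refine (continuousOn_Phi hh n).comp (by fun_prop) fun t ht ↦ ?_
  simp only [Set.mem_Ici]; linarith [ht.1]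

/-- `∫_0^h Φ_n(y+t) dt = Φ_{n+1}(y)` for `y ≥ 1`. [folklore] -/
theorem integral_Phi {h : ℝ} (hh : 0 ≤ h) (n : ℕ) {y : ℝ} (hy : 1 ≤ y) :
    ∫ t in (0 : ℝ)..h, Phi h n (y + t) = Phi h (n + 1) y := by
  simp only [Phi]
  have i1 : IntervalIntegrable (fun t : ℝ ↦ itg h n (L h) (y + t)) volume 0 h := by
    have e : (fun t ↦ itg h n (L h) (y + t)) =
        fun t ↦ h ^ (n + 1) * (y + t + (n + 1) * h / 2 - Real.log (2 * π)) := by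
      ext t; exact itg_L h n (y + t)
    rw [e]; exact (by fun_prop : Continuous fun t : ℝ ↦
      h ^ (n + 1) * (y + t + (n + 1) * h / 2 - Real.log (2 * π))).intervalIntegrable _ _
  have iA := intervalIntegrable_A_shift hh n hy
  have i2 : IntervalIntegrable (fun t : ℝ ↦ (A h n (y + t)).re) volume 0 h := by
    refine ContinuousOn.intervalIntegrable_of_Icc hh ?_
    refine Complex.continuous_re.comp_continuousOn ((continuousOn_A hh n).comp (by fun_prop) fun t ht ↦ ?_)
    simp only [Set.mem_Ici]; linarith [ht.1]
  rw [intervalIntegral.integral_sub i1 i2, ← itg_succ, A_succ]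
  have hre := Complex.reCLM.intervalIntegral_comp_comm iA
  simp only [Complex.reCLM_apply] at hre
  rw [hre]

/-- Auxiliary step (elementary consequence of the definitions and the standing hypotheses). [folklore] -/
theorem div_two_mul_sq_sub_one_anti {x y : ℝ} (hx : 1 < x) (hxy : x ≤ y) :
    y / (2 * (y ^ 2 - 1)) ≤ x / (2 * (x ^ 2 - 1)) := by
  have hx2 : 0 < x ^ 2 - 1 := by nlinarith
  have hy2 : 0 < y ^ 2 - 1 := by nlinarith
  rw [div_le_div_iff₀ (by positivity) (by positivity)]
  nlinarith [mul_nonneg (sub_nonneg.2 hxy) (by nlinarith : (0 : ℝ) ≤ x * y + 1)]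

/-- **The sandwich**: for `x > 1` and `y ≥ x`,
`Φ_n(y) ≤ itg_n D (y) ≤ Φ_n(y) + h^n x/(2(x²−1))` (the remainder `E` of the explicit formula has
`0 ≤ Re E(y+h) − Re E(y) ≤ y/(2(y²−1))`). [cite: RosserSchoenfeld1975, Lemma 8] -/
theorem Phi_le_itg_D_le {h : ℝ} (hh : 0 ≤ h) {x : ℝ} (hx : 1 < x) :
    ∀ (n : ℕ) {y : ℝ}, x ≤ y →
      Phi h n y ≤ itg h n (D h) y ∧ itg h n (D h) y ≤ Phi h n y + h ^ n * (x / (2 * (x ^ 2 - 1))) := by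
  intro n
  induction n with
  | zero =>
    intro y hxy
    have hy : 1 < y := hx.trans_le hxy
    have hyh : y ≤ y + h := by linarith
    have hR := Rone_sub_Rone_eq hy.le hyh
    have hE := re_psiOneRemainder_sub_mem hy hyh
    have hE' := div_two_mul_sq_sub_one_anti hx hxy
    have e : itg h 0 (D h) y - Phi h 0 y = (psiOneRemainder (y + h)).re - (psiOneRemainder y).re := by
      simp only [itg, D, Phi, L, A]
      have : psiOne (y + h) - psiOne y = ((y + h) ^ 2 - y ^ 2) / 2 + (Rone (y + h) - Rone y) := by
        simp only [Rone]; ring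
      rw [this, hR]
      simp only [Complex.sub_re]
      ring
    constructor
    · linarith [hE.1]
    · simp only [pow_zero, one_mul]; linarith [hE.2]
  | succ n ih =>
    intro y hxy
    have hy1 : 1 ≤ y := hx.le.trans hxy
    rw [itg_succ, ← integral_Phi hh n hy1]
    have hmono := itg_monotone hh (D_monotone hh) n
    have iD : IntervalIntegrable (fun t : ℝ ↦ itg h n (D h) (y + t)) volume 0 h :=
      (monotone_shift hmono y).intervalIntegrable
    have iP := intervalIntegrable_Phi_shift hh n hy1
    constructor
    · exact intervalIntegral.integral_mono_on hh iP iD fun t ht ↦ (ih (by linarith [ht.1])).1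
    · calc ∫ t in (0 : ℝ)..h, itg h n (D h) (y + t)
          ≤ ∫ t in (0 : ℝ)..h, (Phi h n (y + t) + h ^ n * (x / (2 * (x ^ 2 - 1)))) :=
            intervalIntegral.integral_mono_on hh iD (iP.add intervalIntegrable_const)
              fun t ht ↦ (ih (by linarith [ht.1])).2
        _ = (∫ t in (0 : ℝ)..h, Phi h n (y + t)) + h ^ (n + 1) * (x / (2 * (x ^ 2 - 1))) := by
            rw [intervalIntegral.integral_add iP intervalIntegrable_const, intervalIntegral.integral_const]
            simp; ring

/-! ### The main inequalities -/

/-- **Upper bound for `ψ` by `m = n+1` differences** (unconditional form of Rosser–Schoenfeld 1975,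
Lemma 8 / Schoenfeld 1976, Thm. 10): if every zero of `ζ` with `|Im ρ| ≤ T` (`T ≥ 1`) has real
part `1/2`, then for `x > 1`, `h > 0`,
`ψ(x) − x ≤ (n+1)h/2 − log 2π + √(x+(n+1)h)·sumInvNorm T + 2^{n+1}(x+(n+1)h)^{n+2} tailPow(n+2,T)/h^{n+1}
  + x/(2h(x²−1))`. [cite: RosserSchoenfeld1975, Lemma 8] [cite: Schoenfeld1976, Thm. 10 (proof)] -/
theorem psi_sub_self_le_general {h : ℝ} (hh : 0 < h) (n : ℕ) {T : ℝ} (hT : 1 ≤ T)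
    (hhalf : ∀ ρ ∈ zerosUpTo T, ((ρ : ℂ)).re = 1 / 2) {x : ℝ} (hx : 1 < x) :
    ψ x - x ≤ (n + 1) * h / 2 - Real.log (2 * π) + Real.sqrt (x + (n + 1) * h) * sumInvNorm T +
      2 ^ (n + 1) * (x + (n + 1) * h) ^ ((n : ℝ) + 2) * tailPow (n + 2) T / h ^ (n + 1) +
      x / (2 * h * (x ^ 2 - 1)) := by
  have h1 := pow_mul_psi_le_itg hh.le n x
  have h2 := (Phi_le_itg_D_le hh.le hx n le_rfl).2
  have h3 := norm_A_le hh n hT hhalf hx.le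
  have hre : -(A h n x).re ≤ ‖A h n x‖ := (neg_le_abs _).trans (Complex.abs_re_le_norm _)
  rw [Phi, itg_L] at h2
  have hhn : 0 < h ^ (n + 1) := pow_pos hh _
  have hx2 : 0 < x ^ 2 - 1 := by nlinarith
  -- `h^{n+1} ψ x ≤ h^{n+1}(x + (n+1)h/2 − log 2π) + ‖A‖ + h^n e`
  have hmain : h ^ (n + 1) * ψ x ≤ h ^ (n + 1) * (x + (n + 1) * h / 2 - Real.log (2 * π)) +
      (h ^ (n + 1) * Real.sqrt (x + (n + 1) * h) * sumInvNorm T +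
        2 ^ (n + 1) * (x + (n + 1) * h) ^ ((n : ℝ) + 2) * tailPow (n + 2) T) +
      h ^ n * (x / (2 * (x ^ 2 - 1))) := by linarith
  have hdiv : ψ x ≤ (x + (n + 1) * h / 2 - Real.log (2 * π)) +
      (Real.sqrt (x + (n + 1) * h) * sumInvNorm T +
        2 ^ (n + 1) * (x + (n + 1) * h) ^ ((n : ℝ) + 2) * tailPow (n + 2) T / h ^ (n + 1)) +
      x / (2 * h * (x ^ 2 - 1)) := by
    rw [← mul_le_mul_iff_right₀ hhn]
    refine hmain.trans (le_of_eq ?_)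
    field_simp
    ring
  linarith

/-- **Lower bound for `ψ` by `m = n+1` differences**: under the same hypothesis on the zeros, for
`h > 0` and `y − (n+1)h > 1`,
`ψ(y) − y ≥ −(n+1)h/2 − log 2π − √y·sumInvNorm T − 2^{n+1} y^{n+2} tailPow(n+2,T)/h^{n+1}`.
[cite: RosserSchoenfeld1975, Lemma 8] [cite: Schoenfeld1976, Thm. 10 (proof)] -/
theorem neg_le_psi_sub_self_general {h : ℝ} (hh : 0 < h) (n : ℕ) {T : ℝ} (hT : 1 ≤ T)
    (hhalf : ∀ ρ ∈ zerosUpTo T, ((ρ : ℂ)).re = 1 / 2) {y : ℝ} (hy : 1 < y - (n + 1) * h) :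
    -((n + 1) * h / 2) - Real.log (2 * π) - Real.sqrt y * sumInvNorm T -
      2 ^ (n + 1) * y ^ ((n : ℝ) + 2) * tailPow (n + 2) T / h ^ (n + 1) ≤ ψ y - y := by
  set x := y - (n + 1) * h with hxdef
  have h1 := itg_le_pow_mul_psi hh.le n y
  have h2 := (Phi_le_itg_D_le hh.le hy n le_rfl).1
  have h3 := norm_A_le hh n hT hhalf hy.le
  rw [← hxdef] at h1
  have hre : (A h n x).re ≤ ‖A h n x‖ := (le_abs_self _).trans (Complex.abs_re_le_norm _)
  rw [Phi, itg_L] at h2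
  have hxy : x + (n + 1) * h = y := by rw [hxdef]; ring
  rw [hxy] at h3
  have hhn : 0 < h ^ (n + 1) := pow_pos hh _
  have hmain : h ^ (n + 1) * (y - (n + 1) * h / 2 - Real.log (2 * π)) -
      (h ^ (n + 1) * Real.sqrt y * sumInvNorm T + 2 ^ (n + 1) * y ^ ((n : ℝ) + 2) * tailPow (n + 2) T)
      ≤ h ^ (n + 1) * ψ y := by
    have e : x + (n + 1) * h / 2 = y - (n + 1) * h / 2 := by rw [hxdef]; ring
    rw [e] at h2
    linarith
  have hdiv : (y - (n + 1) * h / 2 - Real.log (2 * π)) -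
      (Real.sqrt y * sumInvNorm T + 2 ^ (n + 1) * y ^ ((n : ℝ) + 2) * tailPow (n + 2) T / h ^ (n + 1))
      ≤ ψ y := by
    rw [← mul_le_mul_iff_right₀ hhn]
    refine le_trans (le_of_eq ?_) hmain
    field_simp
  linarith

end PsiDifferenced

end Literature.NumberTheory.LFunctions
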